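import Summits.QuantumFields.BalabanUV.T4Continuum.Support.ShellMeasureLiveEndOneCallLevels
import Summits.QuantumFields.BalabanUV.T4Continuum.Support.ShellMeasureLiveEndOneCallToy
import Summits.QuantumFields.BalabanUV.T4Continuum.Support.ShellMeasureLevelZeroBoxWitness

/-!
# `T4Continuum.ShellMeasureLiveEndOneCallLevelsToy` — row S96 f2: RULE G-1 FOR THE LEVEL-INDEXED ONE CALL — S95 f2
# `ShellMeasureLiveEndOneCallLevels.shellWeightBound_live_oneCall_levels` FIRED BY NAME, EVERY BINDER SUPPLIED, on S96 f1's two-run,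
# two-scale (`η = 1`, `η = ½`) toy scheme — the twin of S96 f1 `ShellMeasureLiveEndOneCallToy` under row S95's LIFT RULE
(cell `pub-balaban`, sub-cell `t4`, spine estimate NE7c (node U5b); NE7c ROUND-2 crew, unit `b2b-balaban-t4-ne7c-formalise-leaf-10`
gen 12; OFFER in the journal's PROPOSED∕LANDED lines of S96 f1 (p232958) «S96 f2 = the twin toy on `…OneCallLevels` when it lands»;
row S95 «LEVEL-INDEXED ONE CALL» = leaf-09-g12 (owner g34 R-ne7cp1-g34-1∕-2∕-3: `ShellMeasureLiveEndOneCallSlotLevels` p232688 +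
`ShellMeasureLiveEndOneCallLevels` p232915 + `ShellMeasureLiveEndOneCallUnionLevels` p232965, the read-out∕count rows
`κr κc κwb κcb dbar Kw : Bool → ℕ → ℝ` read at `jl r K s`); ADDITIVE — imports S95 f2, S96 f1 and S89 f1 `ShellMeasureLevelZeroBoxWitness` (for `toyParams`) ONLY (S96 f1's §1 lemmas
and S88's data BY NAME); [folklore]; 0 `def`, 0 `def … : Prop`, 0 sorry, 0 citation tags; §2 is an `example` — its conclusion is
LITERALLY S96 f1's theorem (the dedup lint), the point being the ROUTE through the level-indexed END)

HONEST FRAMING.  A TOY: a CONSISTENCY CERTIFICATE of the hypothesis list of the LEVEL-INDEXED ONE CALL — nothing about Bałaban's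
minimiser, propagators, kernels, densities or counts.  Finite four-torus programme, rung (B)+1 only — NOT infinite volume, NOT a mass
gap, NOT the Clay problem, NOT summit progress; NE7c (`T4IndicatorShell.ShellWeightBound` for the cell's expansions) NOT PRINTED, NOT
PROVED; «NE7c ⇐ the named binders» (c3); `ShellWeightBound` on a toy ≠ NE7c.  HONEST DEPENDENCY (cell): continuum YM on T⁴ ⇐ BetaPertH
∧ nine spine estimates (0/9 proved); BetaPertH ⇐ (D1) ∧ (D4) ∧ CAP+tail; G-an2-4 gates asym, D1 and NE2/3/4.

WHAT.  §2 `example`: S95 f2's END applied BY NAME to EXACTLY the scheme of S96 f1 (σ := Unit, one slot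
per comparison index per run at END-I level `K`, slot = S88's one-plaquette `SU(2)` model at `p r K : Plaq P j`, (T2)∕(T3)∕(S78) = S80
f4's degenerate data as families, scales `η true ≡ 1` ∕ `η false ≡ ½`, `c₁ = 4`, `c₂ = 2`, `zs = 1`, `ε ≡ 4·toyεθ S`, `ρ_j = ϑ^j∕4`, `D ≡
12`, END-I rows on the realized laws pushed with equality), the six LIFTED rows met by CONSTANT level profiles `κr ≡ κc ≡ 3`, `κwb ≡ κcb
≡ 1`, `dbar ≡ 0`, `Kw ≡ 1` (every lifted hypothesis `∀ r K s` then reads as S96 f1's shared one) — conclusion LITERALLY the same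
`ShellWeightBound l₀ (K ↦ {()}) A B shA shB (K ↦ Σ 12·ϑ^K∕4 + Σ 12·ϑ^K∕4)` (positivity of both runs' shell parts and the nonzero
read-out are S96 f1's `shellPart_pos_A`∕`_B`∕`toyReadOut_ne_zero`).  §3: numerics for the GIBBS LEG of the union toy (S96 f3, the
by-name firing of the ONE CALL OF RECORD `…_union_levels`): `sq_le_toyεθ`, `toyεθ_le_sq`, `gibbs_sm`, `gibbs_rad`.  So the two typings (S92 level-blind, S95 level-indexed) are BOTH inhabited by
the same two-scale scheme at `inf η = ½ > 0`; what separates them is the regime `η_j → 0` (F-ne7cL05g9-1 ∕ owner (b): S92 forces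
`κr = κc = 0` there, S95 does not — leaf-09-g12's in-file (x2) `example` via `ShellMeasureLiveEndLevelBlind.levelIndexed_rows`), which
a toy with a FIXED nonzero read-out cannot visit.  NOTHING in the countdown moves.
-/

noncomputable section

open Set Metric NormedSpace MeasureTheory Function

namespace Summit.QuantumFields.BalabanUV.T4Continuum.ShellMeasureLiveEndOneCallLevelsToy

open scoped ENNReal Matrix.Norms.L2Operator
open Literature.MathematicalPhysics.QuantumFieldTheory.Balaban1983to89
open B11Prop6Scheme (Prop4Hyp)
open GaugeField (GaugeInvariant plaqHol)
open T4ShellMeasure (SlotAntiConcentration)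
open T4CubePoincare (cube mem_cube_iff)
open T4CubeChartGnomonic (SU2)
open T4CubeChartExp (expPt expFibreChart)
open T4TreeGaugeFixing (NoClosedLoop fixTo noClosedLoop_empty fixTo_empty)
open T4ExpWindowSmallField (dist1_expPt_eq dist1_eq_norm_coe_sub_one)
open T4ShellMeasurePlaquette (expTail₂)
open T4IndicatorShell (ShellWeightBound)
open T4ShellMeasureLevels (LiveWindow)
open ShellMeasureLevelAssembly (classifier)
open ShellMeasureWilsonWords (wordExp wordExp_cons wordExp_nil)
open ShellMeasureMultiGridNorms (WSup)
open ShellMeasurePinnedNorm (pinW)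
open ShellMeasureDecayKernelSums (kerOp kerOp_apply)
open ShellMeasureLandauHolonomy (solAt landauExp)
open ShellMeasureLandauHolonomyChart (holOf cplx holOf_apply)
open ShellMeasureLandauHolonomySkew (readOutReal)
open ShellMeasureWilsonRealizedSU2 (M₂ gen coe_chart gen_mem_skewAdjoint)
open ShellMeasureLandauEndFinalToy (b₁ toyCentre toyF toyU tau toyReadOut toyJco toyεθ measurable_toyF measurable_toyU
  gaugeInvariant_toyF gaugeInvariant_toyU toyF_le_one toyF_one toyF_supp norm_tau toyReadOut_apply norm_toyReadOut_le
  toyReadOut_cplx solAt_zero landauExp_zero smul_mem_cube toyF_section_mono toyεθ_pos dist1_plaqHol_section toy_threshold_lt_window)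
open ShellMeasureLandauEndFinalToyMass (m₀_eq_three toy_shellMass_eq haar_shell_pos toy_totalMass_pos_le_one)
open ShellMeasureLandauEndAssembledToy (norm_kerOp_zero_le)
open ShellMeasureLiveEndOneCallLevels (shellWeightBound_live_oneCall_levels)
open ShellMeasureLiveEndOneCallToy (lintegral_toyF_ne_top toy_measure_ne_top oneSlot_liveWindow)
open ShellMeasureLevelZeroBoxWitness (toyParams)

variable {P : Params} {j : ℕ}

/-! ## §2 THE ONE CALL APPLIED BY NAME TO THE TOY SCHEME -/

/-- **RULE G-1 FOR THE LEVEL-INDEXED ONE CALL (row S95 f2).**  For every lattice `(P, j)`, plaquette families `p : Bool → ℕ → Plaq P j` (run, comparison index),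
chart enumerations `e r K`, window `0 < S < 1∕6`, rate `0 < ϑ < 1` and source radius `l₀`: S92 f2
`ShellMeasureLiveEndOneCallLevels.shellWeightBound_live_oneCall_levels` APPLIED BY NAME, every one of its binder families met by the
data of S96 f1's module docstring, the LIFTED read-out∕count rows `κr κc κwb κcb dbar Kw` as CONSTANT level profiles `3 3 1 1 0 1` (S88's model per slot, S80 f4-type degenerate (T2)∕(T3)∕(S78) data, scales `η true ≡ 1`, `η false ≡ ½`,
`ε ≡ 4·toyεθ S`, `ρ_j = ϑ^j∕4`, `D ≡ 12`,
one slot and one term per `K`, pieces pushed with equality) — NONE left as a hypothesis — yields END-I's LITERAL `ShellWeightBound`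
for the toy two-run scheme with the weight `K ↦ Σ_{s∈{()}} 12·(ϑ^K∕4) + Σ_{s∈{()}} 12·(ϑ^K∕4)`.  A consistency certificate of the
ONE CALL's hypothesis list; nothing about Bałaban's objects; NE7c NOT PROVED. [folklore] -/
example [DecidableEq (PBond P j)] (p : Bool → ℕ → Plaq P j) {m₀ : Bool → ℕ → ℕ}
    (e : ∀ r K, ↥({b₁ (p r K)} : Finset (PBond P j)) × Fin 3 ≃ Fin (m₀ r K)) {S : ℝ} (hS : 0 < S) (hS6 : S < 1 / 6)
    {ϑ : ℝ} (hϑ0 : 0 < ϑ) (hϑ1 : ϑ < 1) (l₀ : ℝ) :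
    ShellWeightBound l₀ (fun _ : ℕ => ({()} : Finset Unit))
      (fun K _ _ => (((fieldMeasure P j SU2).withDensity (toyF S (p true K))) Set.univ).toReal)
      (fun K _ _ => (((fieldMeasure P j SU2).withDensity (toyF S (p false K))) Set.univ).toReal)
      (fun K _ _ => (((fieldMeasure P j SU2).withDensity (toyF S (p true K)))
        {U | 4 * toyεθ S * (1 - ϑ ^ K / 4) ≤ toyU (p true K) U / 1 ^ 2 ∧ toyU (p true K) U / 1 ^ 2 < 4 * toyεθ S}).toReal)
      (fun K _ _ => (((fieldMeasure P j SU2).withDensity (toyF S (p false K)))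
        {U | 4 * toyεθ S * (1 - ϑ ^ K / 4) ≤ toyU (p false K) U / (1 / 2) ^ 2 ∧ toyU (p false K) U / (1 / 2) ^ 2 < 4 * toyεθ S}).toReal)
      (fun K => ∑ _s ∈ ({()} : Finset Unit), (12 : ℝ) * (ϑ ^ K / 4) + ∑ _s ∈ ({()} : Finset Unit), (12 : ℝ) * (ϑ ^ K / 4)) := by
  have hSπ : 3 * S ^ 2 < Real.pi ^ 2 := by nlinarith [Real.pi_gt_three]
  have hρ1 : ∀ K : ℕ, ϑ ^ K / 4 ≤ (1 - 1 / 2) / 2 := fun K => by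
    have := pow_le_one₀ hϑ0.le hϑ1.le (n := K); linarith
  -- the per-run END-I rows (both runs have the same shape; `r` selects the plaquette family and the scale `cond r 1 ½`)
  set μ : Bool → ℕ → Measure (GaugeField P j SU2) := fun r K => (fieldMeasure P j SU2).withDensity (toyF S (p r K)) with hμ
  set Sh : Bool → ℕ → Set (GaugeField P j SU2) := fun r K =>
    {U | 4 * toyεθ S * (1 - ϑ ^ K / 4) ≤ toyU (p r K) U / cond r 1 (1 / 2) ^ 2 ∧ toyU (p r K) U / cond r 1 (1 / 2) ^ 2 < 4 * toyεθ S}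
    with hSh
  have sh_nonneg : ∀ (r : Bool) (K : ℕ) (t : ℝ), |t| ≤ l₀ → ∀ τ ∈ ({()} : Finset Unit), 0 ≤ (μ r K (Sh r K)).toReal :=
    fun _ _ _ _ _ _ => ENNReal.toReal_nonneg
  have sh_le : ∀ (r : Bool) (K : ℕ) (t : ℝ), |t| ≤ l₀ → ∀ τ ∈ ({()} : Finset Unit),
      (μ r K (Sh r K)).toReal ≤ (μ r K Set.univ).toReal :=
    fun r K _ _ _ _ => ENNReal.toReal_mono (toy_measure_ne_top hS hS6 (p r K) _) (measure_mono (subset_univ _))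
  have cover : ∀ (r : Bool) (K : ℕ) (t : ℝ), |t| ≤ l₀ → ∀ τ ∈ ({()} : Finset Unit),
      (μ r K (Sh r K)).toReal ≤ ∑ _s ∈ ({()} : Finset Unit), (μ r K (Sh r K)).toReal :=
    fun _ _ _ _ _ _ => by rw [Finset.sum_singleton]
  have hM : ∀ (r : Bool) (K : ℕ) (t : ℝ), |t| ≤ l₀ → ∀ s ∈ ({()} : Finset Unit), (0 : ℝ) ≤ 1 :=
    fun _ _ _ _ _ _ => zero_le_one
  have piece_le : ∀ (r : Bool) (K : ℕ) (t : ℝ), |t| ≤ l₀ → ∀ s ∈ ({()} : Finset Unit),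
      ∑ _τ ∈ ({()} : Finset Unit), (μ r K (Sh r K)).toReal ≤ 1 * (μ r K (Sh r K)).toReal :=
    fun _ _ _ _ _ _ => by rw [Finset.sum_singleton, one_mul]
  have total_ge : ∀ (r : Bool) (K : ℕ) (t : ℝ), |t| ≤ l₀ → ∀ s ∈ ({()} : Finset Unit),
      1 * (μ r K Set.univ).toReal ≤ ∑ _τ ∈ ({()} : Finset Unit), (μ r K Set.univ).toReal :=
    fun _ _ _ _ _ _ => by rw [Finset.sum_singleton, one_mul]
  refine shellWeightBound_live_oneCall_levels (σ := Unit) (n := Fin 2) (fun _ _ _ => P) (fun _ _ _ => j) (fun _ K _ => K)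
    (ε := fun _ _ => 4 * toyεθ S) (η := fun r _ => cond r 1 (1 / 2)) (ρ := fun _ j' => ϑ ^ j' / 4) (β := fun _ _ => 0)
    (D := fun _ _ => 12) (fun r _ => by cases r <;> norm_num) (fun _ _ => mul_pos four_pos (toyεθ_pos hS hS6))
    (fun _ _ => by positivity) (fun _ _ => by norm_num)
    (fun _ _ => ({()} : Finset Unit)) (l₀ := l₀)
    (𝒴 := fun r K _ => Fin (m₀ r K) → ℂ) (𝒴' := fun r K _ => Fin (m₀ r K) → ℂ) (𝒳 := fun r K _ => Fin (m₀ r K) → ℂ)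
    (𝒵 := fun r K _ => Fin (m₀ r K) → ℂ) (ℬ := fun r K _ => Fin (m₀ r K) → ℂ) (Tr := fun _ _ _ => ∅)
    (fun _ _ _ => noClosedLoop_empty) (fun _ _ _ _ => 1) (fun r K _ => {b₁ (p r K)}) (m₀ := fun r K _ => m₀ r K)
    (fun r K _ => e r K) hS hSπ (fun r K _ _ => toyCentre (p r K)) (F := fun r K _ _ => toyF S (p r K))
    (fun r K _ _ => measurable_toyF S (p r K)) (fun r K _ _ => gaugeInvariant_toyF S (p r K))
    (fun r K _ _ => toyF_supp S (p r K) 1) (u := fun r K _ _ => toyU (p r K)) (fun r K _ _ => measurable_toyU (p r K))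
    (fun r K _ _ => gaugeInvariant_toyU (p r K)) (ιc := fun _ _ _ => Unit) (Pu := fun _ _ _ _ => {()})
    (fun _ _ _ _ => Finset.singleton_nonempty ()) (fun r K _ _ _ => cube (m₀ r K) S)
    (fun r K _ _ => toyJco S (p r K) (e r K)) (δ := 1 / 2)
    (fun _ _ _ _ _ => 0) (fun _ _ _ _ _ _ => 0) (B₀ := 1) (C₄ := 0) (a₃ := 2 / 3) (ε₄ := 1 / 6)
    (fun _ _ _ _ _ f => by simp) (fun _ _ _ _ _ => ⟨fun Y _ => by simp, differentiableOn_const _⟩) one_pos le_rfl (by norm_num)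
    (dL := 1) (C₁ := 1) (B₃ := 1) (ε₁ := 1 / 12) zero_le_one zero_le_one (by norm_num) le_rfl (by norm_num)
    (by norm_num) (by norm_num)
    (fun r K _ _ _ => ContinuousLinearMap.id ℂ (Fin (m₀ r K) → ℂ)) (fun _ _ _ _ _ B => by simp) (fun _ _ _ _ _ => id) (rΦ := 1 / 6)
    (fun _ _ _ _ _ => differentiableOn_id) (fun _ _ _ _ _ => rfl)
    (fun _ _ _ _ _ z hz => by rw [mem_ball_zero_iff] at hz; simp only [id]; linarith) hS6
    (fun _ _ _ _ _ _ => 0) (C₂ := 0) (RC := 1) le_rfl (fun _ _ _ _ _ Z _ => by simp) (fun _ _ _ _ _ => differentiableOn_const _)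
    (fun _ _ _ _ _ => 0) (fun _ _ _ _ _ Y => by simp) (fun _ _ _ _ _ => 0) (fun _ _ _ _ _ X => by simp) (ε₃ := 1 / 3) (by norm_num)
    (by norm_num) (by norm_num) (fun r K _ _ _ => [toyReadOut (p r K) (e r K)]) (κr := fun _ _ => 3) (fun _ _ _ => by norm_num)
    (fun r K _ _ _ _ ℓ hℓ Y => by rw [List.mem_singleton.1 hℓ]; exact norm_toyReadOut_le (p r K) (e r K) Y) (m := 1)
    (fun _ _ _ _ _ _ => by simp) (κc := fun _ _ => 3) (fun _ _ _ => by norm_num)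
    (fun r K _ _ _ _ Y => by simpa using norm_toyReadOut_le (p r K) (e r K) Y)
    -- ══ (T2): index types `Unit`, fibres `ℂ`, zero pin profile and distance, zero decay kernels ══
    (Λw := fun _ _ _ => Unit) (Λz := fun _ _ _ => Unit) (Λw' := fun _ _ _ => Unit) (Λx := fun _ _ _ => Unit)
    (Λb := fun _ _ _ => Unit) (𝔖 := fun _ _ _ => Unit)
    (𝔄w := fun _ _ _ => ℂ) (ℭ := fun _ _ _ => ℂ) (𝔄' := fun _ _ _ => ℂ) (𝔅 := fun _ _ _ => ℂ) (𝔇 := fun _ _ _ => ℂ)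
    (δw := 0) le_rfl (fun _ _ _ _ _ => 0) (fun _ _ _ _ _ _ => 0) (fun _ _ _ _ _ _ => by simp)
    (fun _ _ _ _ => id) (fun _ _ _ _ => id) (fun _ _ _ _ => id) (fun _ _ _ _ => id) (fun _ _ _ _ => id)
    (fun _ _ _ _ _ _ _ => 0) (fun _ _ _ _ _ _ _ => 0) (fun _ _ _ _ _ _ _ => 0) (fun _ _ _ _ _ _ _ => 0)
    (c𝒢 := 0) (δ𝒢 := 0) (M𝒢 := 1) (cι := 0) (δι := 0) (Mι := 1) (cH := 0) (δH := 0) (MH := 1)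
    (cH₁ := 0) (δH₁ := 0) (MH₁ := 1)
    le_rfl zero_le_one (fun _ _ _ _ _ _ _ => by simp) (fun _ _ _ _ _ => by simp)
    le_rfl zero_le_one (fun _ _ _ _ _ _ _ => by simp) (fun _ _ _ _ _ => by simp)
    le_rfl zero_le_one (fun _ _ _ _ _ _ _ => by simp) (fun _ _ _ _ _ => by simp)
    le_rfl zero_le_one (fun _ _ _ _ _ _ _ => by simp) (fun _ _ _ _ _ => by simp)
    -- the flat lists of the Wilson tuple
    (fun _ _ _ _ _ _ => 0) (B₀w := 1) (C₄w := 0) (a₃w := 2 / 3) (ε₄w := 1 / 6) (bw := 1 / 6)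
    (fun _ _ _ _ _ f => norm_kerOp_zero_le zero_le_one f) (fun _ _ _ _ _ => ⟨fun Y _ => by simp, differentiableOn_const _⟩)
    one_pos le_rfl (by norm_num) (by norm_num) (by norm_num) (by norm_num) (fun _ _ _ _ _ B => norm_kerOp_zero_le zero_le_one B)
    (fun _ _ _ _ _ _ => 0) (rΦw := 1 / 3) (fun _ _ _ _ _ => differentiableOn_const _) (fun _ _ _ _ _ => rfl)
    (fun _ _ _ _ _ z _ => by simp) (by linarith)
    (fun _ _ _ _ _ _ => 0) (C₂w := 0) (RCw := 2) le_rfl (fun _ _ _ _ _ Z _ => by simp) (fun _ _ _ _ _ => differentiableOn_const _)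
    (fun _ _ _ _ _ Y => by simpa using norm_kerOp_zero_le zero_le_one Y) (fun _ _ _ _ _ X => norm_kerOp_zero_le zero_le_one X)
    (by norm_num) (by norm_num)
    -- localities (trivial), reaches `0`, block support, the two contraction numbers
    (fun _ _ _ _ _ _ => True) (fun _ _ _ _ _ A A' c' _ => rfl) (rW := 0) (fun _ _ _ _ _ _ _ => by simp)
    (fun _ _ _ _ _ _ => True) (fun _ _ _ _ _ A A' c' _ => rfl) (rC := 0) (fun _ _ _ _ _ _ _ => by simp)
    (fun _ _ _ _ _ z i _ => rfl) (by norm_num) (by norm_num)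
    -- ONE weight plaquette with ONE zero letter
    (𝔭 := fun _ _ _ => Unit) (fun _ _ _ _ => {()}) (fun _ _ _ _ _ => [0]) (fun _ _ _ _ _ => ∅) (fun _ _ _ _ _ => 0)
    (fun _ _ _ _ _ _ ℓ _ A A' _ => by simp_all) (fun _ _ _ _ _ _ b' hb' => absurd hb' (Finset.notMem_empty _))
    (fun _ _ _ _ _ _ => le_rfl) (κwb := fun _ _ => 1) (κcb := fun _ _ => 1) (fun _ _ _ => zero_le_one) (fun _ _ _ => zero_le_one)
    (fun _ _ _ _ _ _ ℓ hℓ => by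
      rw [List.mem_singleton.1 hℓ]; exact ContinuousLinearMap.opNorm_le_bound _ zero_le_one fun Y => by simp)
    (fun _ _ _ _ _ _ => by
      rw [List.sum_cons, List.sum_nil, add_zero]
      exact ContinuousLinearMap.opNorm_le_bound _ zero_le_one fun Y => by simp)
    (mw := 1) (fun _ _ _ _ _ _ => by simp)
    -- the Wilson tuple's real structure: everything
    (fun _ _ _ _ => ⊤) (fun _ _ _ _ => by simp) (fun _ _ _ _ => ⊤) (fun _ _ _ _ => ⊤) (fun _ _ _ _ => ⊤) (fun _ _ _ _ => by simp)
    (fun _ _ _ _ => ⊤)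
    (fun _ _ _ _ _ f _ => AddSubgroup.mem_top _) (fun _ _ _ _ _ Y _ => AddSubgroup.mem_top _)
    (fun _ _ _ _ _ Y _ => AddSubgroup.mem_top _) (fun _ _ _ _ _ X _ => AddSubgroup.mem_top _)
    (fun _ _ _ _ _ Z _ => AddSubgroup.mem_top _) (fun _ _ _ _ _ B _ => AddSubgroup.mem_top _)
    (fun _ _ _ _ _ y _ => AddSubgroup.mem_top _)
    (fun _ _ _ _ _ _ ℓ hℓ Y _ => by rw [List.mem_singleton.1 hℓ]; simp)
    -- frozen plaquettes `1`, `d = d̄ = 0`, located count `K_w = 1`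
    (fun _ _ _ _ _ _ => 1) (d := fun _ _ _ _ _ => 0) (dbar := fun _ _ => 0) (fun _ _ _ _ _ _ _ => (unitary _).one_mem)
    (fun _ _ _ _ _ _ _ => by simp) (fun _ _ _ _ _ _ => le_rfl) (fun _ _ _ => le_rfl) (Kw := fun _ _ => 1) (fun _ _ _ _ => by simp)
    -- ══ (T3): the located terms' pinned tuple on `Unit → ℂ`, all operators zero, ONE zero term ══
    (Λe := fun _ _ _ => Unit) (𝔄 := fun _ _ _ => ℂ) (δ' := 0) (ϖ := fun _ _ _ _ _ => 0) le_rfl (fun _ _ _ _ _ => le_rfl)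
    (𝒴e' := fun _ _ _ => ℂ) (𝒳e := fun _ _ _ => ℂ) (𝒵e := fun _ _ _ => ℂ) (ℬe := fun _ _ _ => ℂ)
    (fun _ _ _ _ _ => 0) (fun _ _ _ _ _ _ => 0) (B₀e := 1) (C₄e := 0) (a₃e := 2 / 3) (be := 1 / 6) (ε₄e := 1 / 6)
    (fun _ _ _ _ _ f => by simp) (fun _ _ _ _ _ => ⟨fun Y _ => by simp, differentiableOn_const _⟩) one_pos le_rfl (by norm_num)
    (by norm_num) (by norm_num) (by norm_num) (by norm_num)
    (fun _ _ _ _ _ => 0) (fun _ _ _ _ _ B => by simp) (fun _ _ _ _ _ _ => 0) (rΦe := 1 / 3)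
    (fun _ _ _ _ _ => differentiableOn_const _) (fun _ _ _ _ _ => rfl) (fun _ _ _ _ _ z _ => by simp) (by linarith)
    (fun _ _ _ _ _ _ => 0) (C₂e := 0) (RCe := 1) le_rfl (fun _ _ _ _ _ Z _ => by simp) (fun _ _ _ _ _ => differentiableOn_const _)
    (fun _ _ _ _ _ => 0) (fun _ _ _ _ _ Y => by simp) (fun _ _ _ _ _ => 0) (fun _ _ _ _ _ X => by simp) (by norm_num) (by norm_num)
    (𝔱 := fun _ _ _ => Unit) (fun _ _ _ _ => {()}) (Ef := fun _ _ _ _ _ _ => 0) (rE := 1) (ee := fun _ _ _ _ _ => 0) one_pos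
    (fun _ _ _ _ _ _ => differentiableOn_const _) (fun _ _ _ _ _ _ Z _ => by simp) (fun _ _ _ _ _ _ => le_rfl)
    (fun _ _ _ _ _ => ∅) (fun _ _ _ _ _ _ A₁ A₂ _ => rfl) (fun _ _ _ _ _ => 0)
    (fun _ _ _ _ _ _ b' hb' => absurd hb' (Finset.notMem_empty _))
    (LK := 0) le_rfl (fun _ _ _ _ => by simp) (by norm_num) (BE₁ := 0) (fun _ _ _ _ _ y _ => by simp)
    -- ══ (S78): the one-point probability space, `g = 1`, `A = 0`, `B_d = 0` ══
    (Ω := fun _ _ _ => Unit) (fun _ _ _ _ => Measure.dirac ()) (g := fun _ _ _ _ _ => 1) (fun _ _ _ _ _ => zero_le_one)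
    (fun _ _ _ _ _ _ _ => 0) (Bd := 0) le_rfl
    (fun _ _ _ _ _ x _ c' _ _ => by simp) (fun _ _ _ _ _ x _ c' _ _ => by simp) (fun _ _ _ _ _ x _ c' _ _ ω => by simp) (BE₂ := 0)
    (fun _ _ _ _ _ y _ => by simp)
    -- the (T1) real structure and the dictionary (S88 VERBATIM per slot), co-tests, numbers
    (fun r K _ _ => {toyReadOut (p r K) (e r K)}) (fun _ _ _ _ => ⊤) (fun _ _ _ _ => ⊤) (fun _ _ _ _ => ⊤) (fun _ _ _ _ => by simp)
    (fun r K _ _ => readOutReal {toyReadOut (p r K) (e r K)})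
    (fun _ _ _ _ _ f _ => by simp) (fun _ _ _ _ _ Y _ => AddSubgroup.mem_top _)
    (fun _ _ _ _ _ Y _ => AddSubgroup.mem_top _) (fun _ _ _ _ _ X _ => by simp)
    (fun _ _ _ _ _ Z _ => AddSubgroup.mem_top _) (fun _ _ _ _ _ B hB => by simpa using hB)
    (fun r K _ _ _ y _ => ?_) (fun r K _ _ V x hx => ?_) (fun r K _ _ V x _ => ?_)
    (fun r K _ _ V x hJ => ?_) (fun r K _ _ V x a ha => ?_) (fun r K _ _ V x => ?_)
    (fun _ _ _ _ _ => ShellMeasureLandauHolonomyPrint.chartCube_subset_closedBall hS.le)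
    (by norm_num) (by norm_num) (c₁ := 4) (c₂ := 2) (zs := 1)
    (fun r _ _ => by cases r <;> norm_num) (fun r _ _ => by cases r <;> norm_num) (fun _ _ _ => by norm_num) (fun _ _ _ => ?_)
    (fun _ j' => hρ1 j') (fun _ _ => le_rfl)
    -- the slot → level majorant: S80 f3's slot constant on the toy is `12`
    (fun r K _ _ _ _ => by rw [m₀_eq_three (p r K) (e r K)]; norm_num)
    -- END-I's own rows: one term per `K`, total masses as weights, pieces pushed with equality, `M ≡ 1`
    (ι := Unit) (T := fun _ => ({()} : Finset Unit))
    (pieceA := fun K _ _ _ => (μ true K (Sh true K)).toReal) (pieceB := fun K _ _ _ => (μ false K (Sh false K)).toReal)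
    (MA := fun _ _ _ => 1) (MB := fun _ _ _ => 1) (N₁ := 0) (νbar := 1) (Dbar := 12) (crate := 1 / 4) (ϑ := ϑ)
    (fun r K _ _ => lintegral_toyF_ne_top S (p r K))
    (sh_nonneg true) (sh_le true) (cover true) (hM true) (piece_le true) (total_ge true)
    (sh_nonneg false) (sh_le false) (cover false) (hM false) (piece_le false) (total_ge false)
    (fun _ => oneSlot_liveWindow) hϑ0 hϑ1 (fun _ _ => le_rfl) (fun _ j' => le_of_eq (by ring))
  · -- `hΦr`: the read-out of a real chart point is skew (S88's dictionary)
    intro ℓ hℓ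
    rw [Set.mem_singleton_iff.1 hℓ]
    show toyReadOut (p r K) (e r K) (cplx y) ∈ skewAdjoint M₂
    rw [toyReadOut_cplx]; exact gen_mem_skewAdjoint _ _ _ _
  · -- `hRdict`: `F(section x) = Jco V x · e^{−(0 + (0 + 0))}` on the cube — the three DEFINED profiles vanish on the toy data
    rw [fixTo_empty, toyJco, indicator_of_mem hx]
    simp
  · -- `hudict` (S88's dictionary VERBATIM)
    have h1 : expFibreChart {b₁ (p r K)} (1 : GaugeField P j SU2) (e r K) x ⟨b₁ (p r K), Finset.mem_singleton_self _⟩ =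
        expPt (fun i => x (e r K (⟨b₁ (p r K), Finset.mem_singleton_self _⟩, i))) :=
      show (1 : SU2) * _ = _ from one_mul _
    rw [fixTo_empty, toyU, dist1_plaqHol_section, dist1_eq_norm_coe_sub_one, ← h1, coe_chart]
    simp only [classifier, Finset.sup'_singleton, holOf_apply, List.map_cons, List.map_nil, wordExp_cons, wordExp_nil,
      mul_one, landauExp_zero, solAt_zero _ (by norm_num : (0 : ℝ) ≤ 1 / 6), zero_add, ContinuousLinearMap.coe_id',
      id, toyReadOut_cplx]
  · -- `hJW`
    by_contra h
    exact hJ (indicator_of_notMem h _)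
  · -- `hJ`
    unfold toyJco
    by_cases hx : x ∈ cube (m₀ r K) S
    · rw [indicator_of_mem hx, indicator_of_mem (smul_mem_cube hx ha)]
      exact toyF_section_mono hSπ (p r K) (e r K) V hx ha
    · rw [indicator_of_notMem hx]; exact bot_le
  · -- `hJ1`
    unfold toyJco
    by_cases hx : x ∈ cube (m₀ r K) S
    · rw [indicator_of_mem hx]; exact toyF_le_one S (p r K) _
    · rw [indicator_of_notMem hx]; exact bot_le
  · -- `hsm`: (SM) with equality at the threshold `4·toyεθ S` (`c₁ = 4`, `c₂ = 2`, `zs = 1`, `m = 1`)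
    unfold toyεθ
    rw [show (36 : ℝ) * (4 * 1 + ((1 : ℕ) : ℝ) ^ 2 * 2 ^ 2 * 1 ^ 2) = 288 by norm_num,
      show (1 / 2 : ℝ) * (4 * (144 / ((1 / 6) / S - 1) ^ 2)) = 288 / ((1 / 6) / S - 1) ^ 2 by ring]

/-! ## §3 Numerics for the Gibbs leg of the union toy (S96 f3): S88's threshold `toyεθ S` against `S²`, the (SM)₀ display at
window `S`, the reach row at co-test threshold `4·toyεθ S` -/

/-- `5184·S² ≤ toyεθ S` for `0 < S < 1∕6` (`toyεθ S = 144∕((1∕6)∕S − 1)² ≥ 144∕((1∕6)∕S)²`). [folklore] -/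
theorem sq_le_toyεθ {S : ℝ} (hS : 0 < S) (hS6 : S < 1 / 6) : 5184 * S ^ 2 ≤ toyεθ S := by
  have ha : 1 < (1 / 6) / S := by rw [lt_div_iff₀ hS]; linarith
  have h1 : (144 : ℝ) / ((1 / 6) / S) ^ 2 = 5184 * S ^ 2 := by field_simp; ring
  rw [toyεθ, ← h1]
  exact div_le_div_of_nonneg_left (by norm_num) (by nlinarith) (by nlinarith)

/-- `toyεθ S ≤ 20736·S²` for `0 < S ≤ 1∕12` (`(1∕6)∕S − 1 ≥ 1∕(12S)`). [folklore] -/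
theorem toyεθ_le_sq {S : ℝ} (hS : 0 < S) (hS12 : S ≤ 1 / 12) : toyεθ S ≤ 20736 * S ^ 2 := by
  have hR : 1 / (12 * S) ≤ 1 / (6 * S) - 1 := by
    rw [div_sub_one (by positivity), div_le_div_iff₀ (by positivity) (by positivity)]; nlinarith
  have h1 : toyεθ S ≤ 144 / (1 / (12 * S)) ^ 2 := by
    rw [toyεθ, show (1 / 6 : ℝ) / S = 1 / (6 * S) by rw [div_div]]
    exact div_le_div_of_nonneg_left (by norm_num) (by positivity) (pow_le_pow_left₀ (by positivity) hR 2)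
  have h2 : (144 : ℝ) / (1 / (12 * S)) ^ 2 = 20736 * S ^ 2 := by field_simp; ring
  linarith

/-- the (SM)₀ display of the Gibbs face at chart radius `S ≤ 1∕8` against S88's threshold: `4(8S)²e^{16S} ≤ ½·toyεθ S`
(`256·e²·S² ≤ 2592·S²`, `e² < 7.39`). [folklore] -/
theorem gibbs_sm {S : ℝ} (hS : 0 < S) (hS8 : S ≤ 1 / 8) : 4 * (8 * S) ^ 2 * Real.exp (2 * (8 * S)) ≤ 1 / 2 * toyεθ S := by
  have he : Real.exp (2 * (8 * S)) ≤ Real.exp 1 * Real.exp 1 := by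
    rw [← Real.exp_add]; exact Real.exp_le_exp.2 (by linarith)
  have he1 := Real.exp_one_lt_d9
  have he2 : Real.exp (2 * (8 * S)) ≤ 7.39 := by nlinarith [Real.exp_pos 1]
  have h5 := sq_le_toyεθ hS (by linarith)
  calc 4 * (8 * S) ^ 2 * Real.exp (2 * (8 * S)) = 256 * S ^ 2 * Real.exp (2 * (8 * S)) := by ring
    _ ≤ 256 * S ^ 2 * 7.39 := mul_le_mul_of_nonneg_left he2 (by positivity)
    _ ≤ 1 / 2 * (5184 * S ^ 2) := by nlinarith
    _ ≤ 1 / 2 * toyεθ S := by linarith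

/-- the reach row of the Gibbs face on S89 f1's torus `toyParams` (`d = 2`, side-2 box) at co-test threshold `4·toyεθ S` and chart
radius `S ≤ 10⁻⁶`: `(d−1)·2·(4·toyεθ S) ≤ 2S∕π` (`toyεθ S ≤ 20736 S²`, `π ≤ 4`). [folklore] -/
theorem gibbs_rad {S : ℝ} (hS : 0 < S) (hS6 : S ≤ 1 / 10 ^ 6) :
    ((toyParams.d - 1 : ℕ) : ℝ) * ((2 : ℕ) : ℝ) * (4 * toyεθ S) ≤ 2 * S / Real.pi := by
  have h2 := toyεθ_le_sq hS (by linarith)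
  rw [le_div_iff₀ Real.pi_pos]
  simp only [toyParams, Nat.cast_ofNat]
  norm_num
  have h3 : 20736 * S ^ 2 ≤ 20736 * (S * (1 / 10 ^ 6)) := by nlinarith
  nlinarith [Real.pi_le_four, Real.pi_pos]

end Summit.QuantumFields.BalabanUV.T4Continuum.ShellMeasureLiveEndOneCallLevelsToy

end
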